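import Literature.Probability.LatticeModels.IsingConsistency
import Literature.Probability.LatticeModels.IsingBoundaryMonotonicity
import Literature.Probability.LatticeModels.GriffithsMonotonicity
import HarnessLib

/-!
# Monotonicity of finite-volume Ising expectations in the volume, for boundary conditions frozen
# to `±1` on the added sites (FKG), proved

Topic `Probability/LatticeModels`. For the finite-volume Ising model `μ^{η}_{Λ;β,h}` of `IsingModel`
on an arbitrary locally finite graph, `β ≥ 0`, any field `h`, volumes `Λ' ⊆ Λ` and a nondecreasing
measurable observable `f`:

* `le_isingExpect_fixed_of_forall_le` / `isingExpect_fixed_le_of_forall_le` — `⟨f⟩^η_Λ` is a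
  weighted average, over the configurations `τ₂` of `Λ ∖ Λ'`, of the expectations
  `⟨f⟩^{η[τ₂]}_{Λ'}` with the updated boundary conditions `η[τ₂]` (finite-volume DLR consistency,
  Friedli–Velenik 2017, Lemma 6.7, eq. (6.5); the tree's `exists_sum_isingWeight_fixed_eq`), so
  common bounds of the latter bound the former;
* `isingExpect_fixed_anti_volume` — if `η ≡ +1` on `Λ ∖ Λ'` then `⟨f⟩^η_Λ ≤ ⟨f⟩^η_{Λ'}`
  (Friedli–Velenik 2017, Lemma 3.22 (`η ≡ +1`) and Exercise 3.13): each `η[τ₂] ≤ η`, and the FKG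
  monotonicity in the boundary condition (`isingExpect_fixed_mono`, proved in
  `IsingBoundaryMonotonicity`) applies;
* `isingExpect_fixed_mono_volume` — dually, if `η ≡ -1` on `Λ ∖ Λ'` then
  `⟨f⟩^η_{Λ'} ≤ ⟨f⟩^η_Λ`.

These are the volume-monotonicity statements behind the existence of the `+` and `-` states as
monotone limits for boundary conditions that are `±` only on the added sites (e.g. with other
spins frozen, as for the internal-spin systems of van Enter–Fernández–Sokal 1993, §4.3.1 Step 2).

## References

* S. Friedli, Y. Velenik, *Statistical Mechanics of Lattice Systems* (CUP 2017), §3.6.2,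
  Lemma 3.22, Exercise 3.13; Lemma 6.7.
-/

noncomputable section

open MeasureTheory Finset

namespace Literature.Probability.LatticeModels

variable {V : Type*} (G : SimpleGraph V) [DecidableEq V] [G.LocallyFinite]

/-! ### Expectations in a volume are averages of expectations in a sub-volume -/

/-- **The expectation in `Λ` is a weighted average of expectations in `Λ' ⊆ Λ`** over the
configurations `τ₂` of `Λ ∖ Λ'`, which enter as boundary conditions `η[τ₂]` (finite-volume DLR
consistency, Friedli–Velenik 2017, Lemma 6.7, eq. (6.5)); hence a common lower bound of the
`⟨f⟩^{η[τ₂]}_{Λ'}` bounds `⟨f⟩^η_Λ` from below. [cite: FriedliVelenik2017, Lemma 6.7, eq. (6.5)] -/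
theorem le_isingExpect_fixed_of_forall_le {Λ' Λ : Finset V} (hsub : Λ' ⊆ Λ) (η : SpinConfig V)
    (β h : ℝ) {f : SpinConfig V → ℝ} (hf : Measurable f) {m : ℝ}
    (hm : ∀ τ₂ : ↥(Λ \ Λ') → ℤˣ,
      m ≤ isingExpect G Λ' β h (.fixed (glue (Λ \ Λ') τ₂ (.fixed η))) f) :
    m ≤ isingExpect G Λ β h (.fixed η) f := by
  obtain ⟨R, hRpos, hR⟩ := exists_sum_isingWeight_fixed_eq G hsub η β h
  have hnum := hR f
  have hden := hR (fun _ => 1)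
  simp only [mul_one] at hden
  -- the inner sums are `Z(τ₂) ⟨f⟩(τ₂)` and `Z(τ₂)`
  set Z : (↥(Λ \ Λ') → ℤˣ) → ℝ := fun τ₂ =>
    isingPartitionFunction G Λ' β h (.fixed (glue (Λ \ Λ') τ₂ (.fixed η))) with hZ
  set A : (↥(Λ \ Λ') → ℤˣ) → ℝ := fun τ₂ =>
    isingExpect G Λ' β h (.fixed (glue (Λ \ Λ') τ₂ (.fixed η))) f with hA
  have hZpos : ∀ τ₂, 0 < Z τ₂ := fun τ₂ => isingPartitionFunction_pos G Λ' β h _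
  have hinner : ∀ τ₂ : ↥(Λ \ Λ') → ℤˣ,
      ∑ τ₁ : Λ' → ℤˣ, isingWeight G Λ' β h (.fixed (glue (Λ \ Λ') τ₂ (.fixed η))) τ₁ *
        f (glue Λ' τ₁ (.fixed (glue (Λ \ Λ') τ₂ (.fixed η)))) = Z τ₂ * A τ₂ := by
    intro τ₂
    rw [hA, hZ]
    simp only
    rw [isingExpect_eq_sum_div G Λ' h _ β hf, mul_div_cancel₀ _ (hZpos τ₂).ne']
  rw [isingExpect_eq_sum_div G Λ h _ β hf, hnum, isingPartitionFunction, hden]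
  simp only [hinner]
  have hD : 0 < ∑ τ₂ : ↥(Λ \ Λ') → ℤˣ, R τ₂ * ∑ τ₁ : Λ' → ℤˣ,
      isingWeight G Λ' β h (.fixed (glue (Λ \ Λ') τ₂ (.fixed η))) τ₁ :=
    Finset.sum_pos (fun τ₂ _ => mul_pos (hRpos τ₂) (isingPartitionFunction_pos G Λ' β h _))
      Finset.univ_nonempty
  rw [le_div_iff₀ hD, Finset.mul_sum]
  refine Finset.sum_le_sum fun τ₂ _ => ?_
  have : ∑ τ₁ : Λ' → ℤˣ, isingWeight G Λ' β h (.fixed (glue (Λ \ Λ') τ₂ (.fixed η))) τ₁ = Z τ₂ := rfl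
  rw [this]
  have := mul_le_mul_of_nonneg_left (hm τ₂) (mul_pos (hRpos τ₂) (hZpos τ₂)).le
  calc m * (R τ₂ * Z τ₂) = R τ₂ * Z τ₂ * m := by ring
    _ ≤ R τ₂ * Z τ₂ * A τ₂ := this
    _ = R τ₂ * (Z τ₂ * A τ₂) := by ring

/-- Dually, a common upper bound of the `⟨f⟩^{η[τ₂]}_{Λ'}` bounds `⟨f⟩^η_Λ` from above.
[cite: FriedliVelenik2017, Lemma 6.7, eq. (6.5)] -/
theorem isingExpect_fixed_le_of_forall_le {Λ' Λ : Finset V} (hsub : Λ' ⊆ Λ) (η : SpinConfig V)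
    (β h : ℝ) {f : SpinConfig V → ℝ} (hf : Measurable f) {M : ℝ}
    (hM : ∀ τ₂ : ↥(Λ \ Λ') → ℤˣ,
      isingExpect G Λ' β h (.fixed (glue (Λ \ Λ') τ₂ (.fixed η))) f ≤ M) :
    isingExpect G Λ β h (.fixed η) f ≤ M := by
  have hneg : ∀ (Λ₀ : Finset V) (ζ : SpinConfig V),
      isingExpect G Λ₀ β h (.fixed ζ) (-f) = -isingExpect G Λ₀ β h (.fixed ζ) f := by
    intro Λ₀ ζ
    show isingExpect G Λ₀ β h (.fixed ζ) (fun σ => -f σ) = _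
    have := isingExpect_const_mul' G Λ₀ h (.fixed ζ) β (-1) hf
    simpa using this
  have := le_isingExpect_fixed_of_forall_le G hsub η β h hf.neg (m := -M) fun τ₂ => by
    rw [hneg]; exact neg_le_neg (hM τ₂)
  rw [hneg] at this
  exact neg_le_neg_iff.1 this

/-! ### Monotonicity in the volume for boundary conditions frozen to `±1` on the added sites -/

/-- The intermediate boundary conditions `η[τ₂]` lie below `η` when `η ≡ +1` on `Λ ∖ Λ'`.
[cite: FriedliVelenik2017, Lemma 3.22 and Exercise 3.13] -/
theorem glue_sdiff_le_of_eq_one {Λ' Λ : Finset V} {η : SpinConfig V}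
    (hη : ∀ x ∈ Λ \ Λ', η x = 1) (τ₂ : ↥(Λ \ Λ') → ℤˣ) :
    glue (Λ \ Λ') τ₂ (.fixed η) ≤ η := by
  intro x
  by_cases hx : x ∈ Λ \ Λ'
  · rw [glue_apply_of_mem _ _ _ hx, hη x hx]
    exact intUnits_le_one _
  · rw [glue_apply_of_notMem _ _ _ hx, BoundaryCondition.outside_fixed]

/-- Dually, they lie above `η` when `η ≡ -1` on `Λ ∖ Λ'`.
[cite: FriedliVelenik2017, Lemma 3.22 and Exercise 3.13] -/
theorem le_glue_sdiff_of_eq_neg_one {Λ' Λ : Finset V} {η : SpinConfig V}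
    (hη : ∀ x ∈ Λ \ Λ', η x = -1) (τ₂ : ↥(Λ \ Λ') → ℤˣ) :
    η ≤ glue (Λ \ Λ') τ₂ (.fixed η) := by
  intro x
  by_cases hx : x ∈ Λ \ Λ'
  · rw [glue_apply_of_mem _ _ _ hx, hη x hx]
    exact neg_one_le_intUnits _
  · rw [glue_apply_of_notMem _ _ _ hx, BoundaryCondition.outside_fixed]

/-- **Antitonicity in the volume for `+`-frozen boundary conditions** (Friedli–Velenik 2017,
Lemma 3.22 for `η ≡ +1`, and Exercise 3.13: for `β ≥ 0`, `Λ' ⊆ Λ`, a boundary condition `η` equal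
to `+1` on `Λ ∖ Λ'` and a nondecreasing measurable `f`, `⟨f⟩^η_{Λ;β,h} ≤ ⟨f⟩^η_{Λ';β,h}`): the
expectation in `Λ` is an average of expectations in `Λ'` with the boundary conditions `η[τ₂] ≤ η`,
each of which is `≤ ⟨f⟩^η_{Λ'}` by the FKG monotonicity in the boundary condition.
[cite: FriedliVelenik2017, Lemma 3.22 and Exercise 3.13] -/
theorem isingExpect_fixed_anti_volume {β : ℝ} (hβ : 0 ≤ β) {Λ' Λ : Finset V} (hsub : Λ' ⊆ Λ) (h : ℝ)
    {η : SpinConfig V} (hη : ∀ x ∈ Λ \ Λ', η x = 1) {f : SpinConfig V → ℝ} (hf : Monotone f)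
    (hfm : Measurable f) :
    isingExpect G Λ β h (.fixed η) f ≤ isingExpect G Λ' β h (.fixed η) f :=
  isingExpect_fixed_le_of_forall_le G hsub η β h hfm fun τ₂ =>
    isingExpect_fixed_mono G hβ Λ' h (glue_sdiff_le_of_eq_one hη τ₂) hf hfm

/-- **Monotonicity in the volume for `-`-frozen boundary conditions**: for `β ≥ 0`, `Λ' ⊆ Λ`, `η`
equal to `-1` on `Λ ∖ Λ'` and a nondecreasing measurable `f`, `⟨f⟩^η_{Λ';β,h} ≤ ⟨f⟩^η_{Λ;β,h}`.
[cite: FriedliVelenik2017, Lemma 3.22 and Exercise 3.13] -/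
theorem isingExpect_fixed_mono_volume {β : ℝ} (hβ : 0 ≤ β) {Λ' Λ : Finset V} (hsub : Λ' ⊆ Λ) (h : ℝ)
    {η : SpinConfig V} (hη : ∀ x ∈ Λ \ Λ', η x = -1) {f : SpinConfig V → ℝ} (hf : Monotone f)
    (hfm : Measurable f) :
    isingExpect G Λ' β h (.fixed η) f ≤ isingExpect G Λ β h (.fixed η) f :=
  le_isingExpect_fixed_of_forall_le G hsub η β h hfm fun τ₂ =>
    isingExpect_fixed_mono G hβ Λ' h (le_glue_sdiff_of_eq_neg_one hη τ₂) hf hfm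

end Literature.Probability.LatticeModels

end
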